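import Literature.Barriers.QuantumAdvantage.AaronsonChenOracle
import Literature.Computability.QuantumComplexity.HybridArgument
import Literature.Computability.Cryptography.StatisticalDistanceProofs
import Literature.Computability.Cryptography.StatisticalDistanceMapProofs
import HarnessLib

/-!
# Aaronson–Chen 2017, Lemma 5.3 (the simulation lemma): the replacement process of §5.3 and the decomposition of `aaronsonChen2017_lem53`

Support file for the named fact `aaronsonChen2017_lem53` of `AaronsonChenOracle.lean`, which
vendors, in the tree's models,

* S. Aaronson, L. Chen, *Complexity-theoretic foundations of quantum supremacy experiments*,
  CCC 2017 (arXiv:1612.05903) [AaronsonChen2017], **Lemma 5.3** (p. 21): "For any `SampBQP`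
  oracle algorithm `M`, there is a `SampBPP` oracle algorithm `A` such that: Let `O` be an oracle
  drawn from `𝒟_O` … Then with probability at least `1 − exp{−(2|x| + 1/ε)}`, we have
  `‖𝒟^M_{x,ε} − 𝒟^A_{x,ε}‖ ≤ ε`."

**The printed proof** (pp. 21–23). `M` builds, on `⟨x, 0^{1/ε}⟩`, a circuit `C` with `T`
`O`-gates (canonical form, §2.2). `A` "proceeds by replacing each `O`-gate by a much simpler
gate, one by one, without affecting the final quantum state too much. It then simulates the
final circuit with the help of the `TQBF` oracle" (p. 22): before the `t`-th `O`-gate, with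
`|v⟩` the state of the already-replaced circuit and `Q` the distribution of its query register,
`A` queries all strings `x` with `Q(x) ≥ τ` (and the whole table `f_n` when it is polynomially
small, "`2^{2n} = O(T⁴ε⁻⁸)` queries"), and replaces `f = f_n` by `g` := the known ones
(`g(x) = f_known(x)` where known, `0` elsewhere). The error of one replacement is
`‖(U_f − U_g) ⊗ I |v⟩‖² = 4·Pr_{i∼Q}[f(i) ≠ g(i)]` (eqs. (7)–(8)); under the posterior of `𝒟_n`
given the queries, `X = Σ_p X_p` with independent `X_p ∈ [0, τ]` and `μ = 𝔼 X ≤ 2^{-n}`, so the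
multiplicative Chernoff bound (Cor. 2.7) with `τ = ε⁴/(96T²(2n + ε⁻¹ + ln T))` gives, with
probability `1 − exp(−(2n + ε⁻¹))/T`, `‖(U_f − U_g) ⊗ I |v⟩‖ ≤ ε²/2T` (eq. (9)); a union bound and
the telescoping/unitarity induction (eq. (10)) give `‖U|0⟩ − V|0⟩‖ ≤ ε²/2` with probability
`≥ 1 − exp(−(2|x| + ε⁻¹))`; "`A` then simulates stage 2 and 3 … it first takes a sample `z` by
measuring `|v_{T+1}⟩` … all the computations can be done in `PSPACE`, and therefore can be
implemented in `poly(n, 1/ε)` time with the help of the `TQBF` oracle. So `A` is a `SampBPP`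
algorithm" (p. 23), and Cor. 2.5 (`‖𝒟(φ₀) − 𝒟(φ₁)‖ ≤ √(2ε)`) concludes.

**What this file does.** It defines the replacement process as REAL objects in the tree's Q2
model (XOR query gates to the joined language `TQBF ⊕ O`; the `t`-th gate of the replaced run
answers `TQBF ⊕ (O ∩ K_t)`, `K_t` the set of strings of `O` queried so far), proves the
deterministic half of the analysis, and reduces `aaronsonChen2017_lem53`, by a proof, to two
named facts — one per half of the printed proof that needs a theory the tree lacks:

* `AcSim.State`, `AcSim.heavySet` (strings `w` with `Q(1w) ≥ 1/a`), `AcSim.smallSet` (the whole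
  length class when `2^{|w|} ≤ b`), `AcSim.newKnown`, `AcSim.unknownOnes`, `AcSim.step`,
  `AcSim.run` (the replaced run), `AcSim.lossOf`/`AcSim.losses` (the error terms
  `X_t = Pr_{i∼Q_t}[f(i) ≠ g_t(i)]` of eq. (8), as query magnitudes of the unknown ones),
  `acSimParam c input T = (|input| + T + 2)^c` (the polynomial budget `a = b`), `acSimInit`,
  `acSimRun`, `acSimState` (`V|input, 0^m⟩`), `acSimLosses`, `acSimPMF` (measure `V|input,0^m⟩`,
  read the outcome as a string, post-process), `acTrueState` (`U|input, 0^m⟩`);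
* PROVED: `AcSim.l2Norm_step_sub_le` (eqs. (7)–(8) as the inequality
  `‖(U_f − U_g)|v⟩‖ ≤ 2√X` for XOR gates, from the tree's BBBV lemma
  `normSq_oracleGate_sub_mulVec_le`), `AcSim.l2Norm_run_sub_le` (eq. (10): telescoping +
  unitarity, `‖U|ψ⟩ − V|ψ⟩‖ ≤ Σ_t 2√X_t`), `AcSim.normSq_run_vec`/`normSq_acSimState` (the
  replaced run is unitary), `tvDist_bornPMF_le_l2Norm` (measuring unit vectors at `ℓ²`-distance
  `δ` gives outcome laws at total variation `≤ δ` — the Bernstein–Vazirani form of Cor. 2.5,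
  sharper than `√(2δ)`), `kernel_eq_map_bornPMF_acTrueState`;
* NAMED FACTS: `aaronsonChen2017_lem53_machine` (the `SampBPP^{TQBF,O}` machine: for every
  budget exponent `c` a PPT oracle adversary whose output law at `TQBF ⊕ O` is within total
  variation `1/2k` of `acSimPMF`, for every `O` — the sentence "all the computations can be done
  in PSPACE … with the help of the TQBF oracle", which needs `TQBF`'s `PSPACE`-completeness
  (Stockmeyer–Meyer; Arora–Barak Thm. 4.13), a space-bounded path-sum evaluation of Clifford+T
  oracle circuits relative to `TQBF`, and an inverse-CDF sampler, none of which the tree has) and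
  `aaronsonChen2017_lem53_losses` (the probabilistic half: for some `c`, with probability
  `≥ 1 − exp(−(2|x| + k))` over `O ∼ 𝒟_O`, `Σ_t 2√X_t ≤ 1/2k` — posterior of `𝒟_n`, Cor. 2.7,
  union bound);
* PROVED REDUCTIONS: `aaronsonChen2017_lem53_analysis_of_losses` (state closeness
  `‖U|ψ⟩ − V|ψ⟩‖ ≤ 1/2k` with the printed probability, from the losses fact and eq. (10)) and the
  assembly `aaronsonChen2017_lem53_of_machine_of_analysis`, `aaronsonChen2017_lem53_of_parts`
  (`machine → losses → aaronsonChen2017_lem53`: triangle inequality and data processing for the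
  total variation distance, `tvDist_bornPMF_le_l2Norm`, monotonicity of `𝒟_O`).

## Design notes

* Constants. The tree's sampling classes fix `ε = 1/k`; since measuring states at `ℓ²`-distance
  `δ` moves the outcome law by at most `δ` (not `√(2δ)`), the state-distance target is `1/2k` and
  the remaining `1/2k` is the sampler's slack in `aaronsonChen2017_lem53_machine` (a classical
  machine with finitely many coins samples the Born law of a Clifford+T state, whose
  probabilities lie in `ℤ[√2]·2^{-j}`, only approximately). The query threshold `τ = 1/a` and the
  small-table bound `b` are both the polynomial `(|input| + T + 2)^c` (`input = ⟨x, 1^k⟩` has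
  length `2|x| + 2 + k`, `T` = number of oracle gates); `c` is universally quantified in the
  machine fact and existentially in the losses fact, so the two halves are decoupled (the printed
  `τ = ε⁴/(96T²(2n + ε⁻¹ + ln T))`, with the printed `n` — there the half-arity of the gate — read
  as `|x|`, and the printed small-table rule `32T²ε⁻⁴ ≥ 2ⁿ`, are both met by one fixed `c`, whose
  existence is all the losses fact asks for).
* One oracle. In the tree's model the circuit has a single kind of query gate, answered by the
  joined language `TQBF ⊕ O` (`AaronsonChenOracle.lean`); the strings reaching `O` are the queries
  `1w`, so the heavy set, the small set and the error terms are over the tails `w` of such queries,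
  and replacing "the `O`-gate `f` by `g`" is replacing the language `TQBF ⊕ O` by
  `TQBF ⊕ (O ∩ K)`; the two agree outside `{1w : w ∈ O ∖ K}` (`AcSim.oracleJoin_iff_of_notMem`).
* The replaced run answers the `t`-th gate by its own language, so the tree's two-language hybrid
  bound `l2Norm_toMatrix_sub_le` is re-proved along the process (`AcSim.l2Norm_run_sub_le`, same
  telescoping), the query magnitudes being those of the replaced run, as in the paper.

## Sources

* [AaronsonChen2017] arXiv:1612.05903, read via `lit read arxiv:1612.05903 --pages 11-14` and
  `--pages 19-25`: Def. 2.3 and §2.2 (p. 12), Cor. 2.5, Lemma 2.6, Cor. 2.7 (p. 13), §5.2–5.3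
  (pp. 20–23: `𝒟_O`, Thm. 5.1, Lemma 5.3 and its proof, eqs. (7)–(10)).
* [BennettBernsteinBrassardVazirani1997] Thm. 3.1, Thm. 3.3 (hybrid argument), as proved in the
  tree's `Literature/Computability/QuantumComplexity/HybridArgument.lean`.
* [AroraBarakCC2009] Thm. 4.13 (`TQBF` is `PSPACE`-complete [SM73]), as cited in
  `AaronsonChenOracle.lean`.
-/

noncomputable section

namespace Literature.Barriers.QuantumAdvantage

open MeasureTheory _root_.Computability Matrix Literature.Computability.Complexity
  Literature.Computability.Cryptography Literature.Computability.QuantumComplexity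

variable {G : QGateSet} {N : ℕ}

/-! ### The replacement process of §5.3 -/

namespace AcSim

/-- A stage of the replacement process: the set `K` of strings of `O` queried so far ("we use a
function `f_known` to encode our knowledge") and the state vector of the replaced run ("`|v⟩`,
the quantum state right before the `t`-th `O` gate in the circuit after the replacement").
[cite: AaronsonChen2017, §5.3 (p. 22, "Replacing the t-th O-gate")] -/
structure State (N : ℕ) where
  /-- The strings of the oracle `O` queried so far. -/
  known : Set (List Bool)
  /-- The current state vector of the replaced run. -/
  vec : QReg N → ℂ

/-- The heavy tails at a query gate with `k` query wires placed by `e`, in the state `φ`: the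
strings `w`, `|w| + 1 = k`, whose `O`-query `1w` has query magnitude `Q(1w) ≥ 1/a` ("we query all
`x ∈ {0,1}^{2n}` with `Q(x) ≥ τ`", `τ = 1/a`). [cite: AaronsonChen2017, §5.3 (p. 22, "Construction and Analysis of g")] -/
def heavySet (a : ℕ) {k : ℕ} (e : Fin (k + 1) ↪ Fin N) (φ : QReg N → ℂ) : Set (List Bool) :=
  {w | w.length + 1 = k ∧ (1 : ℝ) / a ≤ queryWeight ({true :: w} : Set (List Bool)) e φ}

/-- The small tables at a query gate with `k` query wires: all tails `w`, `|w| + 1 = k`, provided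
`2^{|w|} ≤ b` ("we can simply query all the positions in `f_n` using `2^{2n} = O(T⁴·ε⁻⁸)`
queries, as this bound is polynomial"). [cite: AaronsonChen2017, §5.3 (p. 22, "Applying the Chernoff Bound")] -/
def smallSet (b k : ℕ) : Set (List Bool) :=
  {w | w.length + 1 = k ∧ 2 ^ w.length ≤ b}

/-- The knowledge after the queries made at a query gate: the old knowledge, the heavy tails and
the small tables. [cite: AaronsonChen2017, §5.3 (p. 22, "Construction and Analysis of g")] -/
def newKnown (a b : ℕ) (s : State N) {k : ℕ} (e : Fin (k + 1) ↪ Fin N) : Set (List Bool) :=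
  s.known ∪ (heavySet a e s.vec ∪ smallSet b k)

/-- The queries on which `TQBF ⊕ O` and its replacement `TQBF ⊕ (O ∩ K)` differ: the `O`-queries
`1w` of the unknown ones `w ∈ O ∖ K` ("`f(x) ≠ g(x)`"). [cite: AaronsonChen2017, §5.3 (p. 22, eq. (8))] -/
def unknownOnes (O K : Set (List Bool)) : Set (List Bool) :=
  {z | ∃ w : List Bool, z = true :: w ∧ w ∈ O ∧ w ∉ K}

/-- One gate of the replaced run: a gate symbol acts as itself; at a query gate the process first
queries the heavy tails and the small tables and then applies the query gate of the replacement
language `TQBF ⊕ (O ∩ K)` ("we replaced the `f_{n_i}` gate with a `g_i` gate", `g` = the known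
ones). [cite: AaronsonChen2017, §5.3 (p. 22)] -/
def step (O : Set (List Bool)) (a b : ℕ) (s : State N) : QGate G N → State N
  | .gate g e => ⟨s.known, placeGate e (G.mat g) *ᵥ s.vec⟩
  | .oracle k e =>
    ⟨newKnown a b s e,
      placeGate e (oracleGate (oracleJoin TQBF (O ∩ newKnown a b s e : Set (List Bool))) k) *ᵥ s.vec⟩

/-- The replaced run along a gate list (head first), from a stage `s`; its final state vector is
`V|ψ⟩` for the "final circuit `C_final`". [cite: AaronsonChen2017, §5.3 (p. 23, "Analysis of the final circuit")] -/
def run (O : Set (List Bool)) (a b : ℕ) : List (QGate G N) → State N → State N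
  | [], s => s
  | g :: gs, s => run O a b gs (step O a b s g)

/-- The error term of one gate: none for a gate symbol; for a query gate the query magnitude
`X = Σ_x Q(x)·[f(x) ≠ g(x)]` of the unknown ones in the current state (eq. (8), as a query
magnitude in the sense of BBBV). [cite: AaronsonChen2017, §5.3 (p. 22, eq. (8) and "X = Σ_p X_p")] -/
def lossOf (O : Set (List Bool)) (a b : ℕ) (s : State N) : QGate G N → List ℝ
  | .gate _ _ => []
  | .oracle _ e => [queryWeight (unknownOnes O (newKnown a b s e)) e s.vec]

/-- The error terms `X_1, …, X_T` of the successive query gates of the replaced run.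
[cite: AaronsonChen2017, §5.3 (pp. 22–23, eqs. (8)–(9))] -/
def losses (O : Set (List Bool)) (a b : ℕ) : List (QGate G N) → State N → List ℝ
  | [], _ => []
  | g :: gs, s => lossOf O a b s g ++ losses O a b gs (step O a b s g)

/-- The run on the empty gate list (definitional). [folklore] -/
@[simp] theorem run_nil (O : Set (List Bool)) (a b : ℕ) (s : State N) :
    run (G := G) O a b [] s = s := rfl

/-- The run on `g :: gs` (definitional). [folklore] -/
@[simp] theorem run_cons (O : Set (List Bool)) (a b : ℕ) (g : QGate G N) (gs : List (QGate G N))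
    (s : State N) : run O a b (g :: gs) s = run O a b gs (step O a b s g) := rfl

/-- No error terms on the empty gate list (definitional). [folklore] -/
@[simp] theorem losses_nil (O : Set (List Bool)) (a b : ℕ) (s : State N) :
    losses (G := G) O a b [] s = [] := rfl

/-- The error terms on `g :: gs` (definitional). [folklore] -/
@[simp] theorem losses_cons (O : Set (List Bool)) (a b : ℕ) (g : QGate G N) (gs : List (QGate G N))
    (s : State N) : losses O a b (g :: gs) s = lossOf O a b s g ++ losses O a b gs (step O a b s g) := rfl

/-- Error terms are nonnegative. [folklore] -/
theorem losses_nonneg (O : Set (List Bool)) (a b : ℕ) :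
    ∀ (gs : List (QGate G N)) (s : State N), ∀ q ∈ losses O a b gs s, 0 ≤ q
  | [], _ => by simp
  | g :: gs, s => by
    intro q hq
    rw [losses_cons, List.mem_append] at hq
    rcases hq with hq | hq
    · cases g with
      | gate g e => simp [lossOf] at hq
      | oracle k e =>
        simp only [lossOf, List.mem_singleton] at hq
        rw [hq]
        exact queryWeight_nonneg _ _ _
    · exact losses_nonneg O a b gs _ q hq

/-- `TQBF ⊕ O` and its replacement `TQBF ⊕ (O ∩ K)` agree outside the `O`-queries of the unknown
ones. [cite: AaronsonChen2017, §5.3 (p. 22, properties of g)] -/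
theorem oracleJoin_iff_of_notMem (O K : Set (List Bool)) {z : List Bool}
    (hz : z ∉ unknownOnes O K) :
    z ∈ oracleJoin TQBF (O ∩ K : Set (List Bool)) ↔ z ∈ oracleJoin TQBF O := by
  cases z with
  | nil => simp
  | cons c w =>
    cases c
    · simp
    · simp only [true_cons_mem_oracleJoin]
      refine ⟨fun h => h.1, fun h => ⟨h, ?_⟩⟩
      by_contra hK
      exact hz ⟨w, rfl, h, hK⟩

/-- **One replacement** (eqs. (7)–(8) for the XOR query gate): the replaced gate moves the state by
at most `2√X`, `X` the query magnitude of the unknown ones; a gate symbol is not changed.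
[cite: AaronsonChen2017, §5.3 (p. 22, eqs. (7)–(8))] -/
theorem l2Norm_step_sub_le (O : Set (List Bool)) (a b : ℕ) (s : State N) (g : QGate G N) :
    l2Norm (g.toMatrix (oracleJoin TQBF O) *ᵥ s.vec - (step O a b s g).vec) ≤
      ((lossOf O a b s g).map fun q => 2 * Real.sqrt q).sum := by
  cases g with
  | gate g e => simp [step, lossOf]
  | oracle k e =>
    simp only [step, lossOf, List.map_cons, List.map_nil, List.sum_cons, List.sum_nil, add_zero,
      QGate.toMatrix_oracle]
    rw [← Matrix.sub_mulVec]
    refine l2Norm_le_of_normSq_le (by positivity) ?_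
    rw [mul_pow, Real.sq_sqrt (queryWeight_nonneg _ _ _)]
    norm_num
    exact normSq_oracleGate_sub_mulVec_le
      (fun z hz => oracleJoin_iff_of_notMem O (newKnown a b s e) hz) e s.vec

/-- **The hybrid bound along the replacement process** (eq. (10) summed: telescoping and
unitarity of the true run): over a unitary gate set,
`‖U^{TQBF ⊕ O}_C |ψ⟩ − V|ψ⟩‖₂ ≤ Σ_t 2√X_t`. [cite: AaronsonChen2017, §5.3 (p. 23, eqs. (9)–(10))] -/
theorem l2Norm_run_sub_le (hG : G.IsUnitary) (O : Set (List Bool)) (a b : ℕ) :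
    ∀ (gs : List (QGate G N)) (s : State N),
      l2Norm ((⟨gs⟩ : QCircuit G N).toMatrix (oracleJoin TQBF O) *ᵥ s.vec - (run O a b gs s).vec) ≤
        ((losses O a b gs s).map fun q => 2 * Real.sqrt q).sum
  | [], s => by simp
  | g :: gs, s => by
    have ih := l2Norm_run_sub_le hG O a b gs (step O a b s g)
    rw [QCircuit.toMatrix_cons, ← Matrix.mulVec_mulVec]
    simp only [run_cons, losses_cons, List.map_append, List.sum_append]
    refine (l2Norm_sub_le _
      ((⟨gs⟩ : QCircuit G N).toMatrix (oracleJoin TQBF O) *ᵥ (step O a b s g).vec) _).trans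
      (add_le_add ?_ ih)
    rw [← Matrix.mulVec_sub, l2Norm_mulVec_of_mem_unitaryGroup
      (QCircuit.toMatrix_mem_unitaryGroup_holds hG (oracleJoin TQBF O) ⟨gs⟩)]
    exact l2Norm_step_sub_le O a b s g

/-- One gate of the replaced run preserves the norm (placements of unitaries and query gates are
unitary). [folklore] -/
theorem normSq_step_vec (hG : G.IsUnitary) (O : Set (List Bool)) (a b : ℕ) (s : State N)
    (g : QGate G N) : normSq (step O a b s g).vec = normSq s.vec := by
  cases g with
  | gate g e => exact normSq_mulVec_of_mem_unitaryGroup (placeGate_mem_unitaryGroup_holds e (hG g)) _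
  | oracle k e =>
    exact normSq_mulVec_of_mem_unitaryGroup
      (placeGate_mem_unitaryGroup_holds e (oracleGate_mem_unitaryGroup_holds _ k)) _

/-- The replaced run preserves the norm. [folklore] -/
theorem normSq_run_vec (hG : G.IsUnitary) (O : Set (List Bool)) (a b : ℕ) :
    ∀ (gs : List (QGate G N)) (s : State N), normSq (run O a b gs s).vec = normSq s.vec
  | [], _ => rfl
  | g :: gs, s => (normSq_run_vec hG O a b gs _).trans (normSq_step_vec hG O a b s g)

/-- On an oracle-free gate list the process makes no error terms. [folklore] -/
theorem losses_eq_nil_of_isOracleFree (O : Set (List Bool)) (a b : ℕ) :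
    ∀ (gs : List (QGate G N)), (∀ g ∈ gs, g.IsOracleFree) → ∀ s : State N, losses O a b gs s = []
  | [], _, _ => rfl
  | g :: gs, hgs, s => by
    cases g with
    | gate g e =>
      rw [losses_cons, losses_eq_nil_of_isOracleFree O a b gs (fun g' hg' => hgs g' (by simp [hg'])) _]
      rfl
    | oracle k e => exact absurd (hgs (QGate.oracle k e) (by simp)) id

/-- On an oracle-free gate list the replaced run is the true run (sanity check: the process only
touches query gates). [folklore] -/
theorem run_vec_of_isOracleFree (O : Set (List Bool)) (a b : ℕ) :
    ∀ (gs : List (QGate G N)), (∀ g ∈ gs, g.IsOracleFree) → ∀ s : State N,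
      (run O a b gs s).vec = (⟨gs⟩ : QCircuit G N).toMatrix (oracleJoin TQBF O) *ᵥ s.vec
  | [], _, s => by simp
  | g :: gs, hgs, s => by
    cases g with
    | gate g e =>
      rw [run_cons, run_vec_of_isOracleFree O a b gs (fun g' hg' => hgs g' (by simp [hg'])) _,
        QCircuit.toMatrix_cons, ← Matrix.mulVec_mulVec]
      rfl
    | oracle k e => exact absurd (hgs (QGate.oracle k e) (by simp)) id

end AcSim

/-! ### The process on the circuit of a family, run on `⟨x, 1^k⟩` -/

/-- The polynomial budget of the process on the input `input = ⟨x, 1^k⟩` of a circuit with `T`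
query gates: `(|input| + T + 2)^c` — used both as `a` (query threshold `τ = 1/a`) and as `b`
(small tables), so that the process makes polynomially many queries for every fixed `c`.
[cite: AaronsonChen2017, §5.3 (p. 22: "τ = ε⁴/(96T²(2n + ε⁻¹ + ln T))", "2^{2n} = O(T⁴ε⁻⁸) queries")] -/
def acSimParam (c : ℕ) (input : List Bool) (T : ℕ) : ℕ :=
  (input.length + T + 2) ^ c

/-- The initial stage on the input `input`: nothing known, state `|input⟩|0^m⟩`.
[cite: AaronsonChen2017, §2.2 (p. 12, canonical form) and §5.3] -/
def acSimInit (F : QCircuitFamily G) (input : List Bool) :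
    AcSim.State (input.length + F.ancillas input.length) :=
  ⟨∅, basisState (padInput input.get (F.ancillas input.length))⟩

/-- The replaced run of the family's circuit on `input`, with budget exponent `c`, against the
oracle `O`. [cite: AaronsonChen2017, §5.3 (pp. 22–23)] -/
def acSimRun (F : QCircuitFamily G) (O : Set (List Bool)) (c : ℕ) (input : List Bool) :
    AcSim.State (input.length + F.ancillas input.length) :=
  AcSim.run O (acSimParam c input (F.circ input.length).oracleQueries)
    (acSimParam c input (F.circ input.length).oracleQueries) (F.circ input.length).gates
    (acSimInit F input)

/-- The final state `V|input, 0^m⟩` of the replaced run. [cite: AaronsonChen2017, §5.3 (p. 23, "V|0⟩^{⊗N}")] -/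
def acSimState (F : QCircuitFamily G) (O : Set (List Bool)) (c : ℕ) (input : List Bool) :
    QReg (input.length + F.ancillas input.length) → ℂ :=
  (acSimRun F O c input).vec

/-- The error terms `X_1, …, X_T` of the replaced run of the family's circuit on `input`.
[cite: AaronsonChen2017, §5.3 (pp. 22–23, eqs. (8)–(9))] -/
def acSimLosses (F : QCircuitFamily G) (O : Set (List Bool)) (c : ℕ) (input : List Bool) : List ℝ :=
  AcSim.losses O (acSimParam c input (F.circ input.length).oracleQueries)
    (acSimParam c input (F.circ input.length).oracleQueries) (F.circ input.length).gates
    (acSimInit F input)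

/-- The target law of the classical simulator: measure `V|input, 0^m⟩` in the computational
basis, read the outcome as a bit string and post-process it ("it first takes a sample `z` by
measuring `|v_{T+1}⟩` in the computational basis, and then outputs `A^output(z)`").
[cite: AaronsonChen2017, §5.3 (p. 23)] -/
def acSimPMF (F : QCircuitFamily G) (post : List Bool → List Bool) (O : Set (List Bool)) (c : ℕ)
    (input : List Bool) : PMF (List Bool) :=
  ((bornPMF (acSimState F O c input)).map List.ofFn).map post

/-- The true final state `U|input, 0^m⟩` of the family's circuit run with the oracle `TQBF ⊕ O`.
[cite: AaronsonChen2017, §5.3 (p. 23, "U|0⟩^{⊗N}")] -/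
def acTrueState (F : QCircuitFamily G) (O : Set (List Bool)) (input : List Bool) :
    QReg (input.length + F.ancillas input.length) → ℂ :=
  (F.circ input.length).runOn (oracleJoin TQBF O) (basisState (padInput input.get (F.ancillas input.length)))

/-- The family's kernel at `TQBF ⊕ O` is the Born law of the true final state read as a string
(definitional). [folklore] -/
theorem kernel_eq_map_bornPMF_acTrueState (F : QCircuitFamily G) (O : Set (List Bool))
    (input : List Bool) :
    F.kernel (oracleJoin TQBF O) input = (bornPMF (acTrueState F O input)).map List.ofFn := rfl

/-- The true final state is a unit vector (unitary gate set). [folklore] -/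
theorem normSq_acTrueState (hG : G.IsUnitary) (F : QCircuitFamily G) (O : Set (List Bool))
    (input : List Bool) : normSq (acTrueState F O input) = 1 :=
  QCircuit.normSq_runOn_basisState hG _ _ _

/-- The final state of the replaced run is a unit vector (unitary gate set). [folklore] -/
theorem normSq_acSimState (hG : G.IsUnitary) (F : QCircuitFamily G) (O : Set (List Bool)) (c : ℕ)
    (input : List Bool) : normSq (acSimState F O c input) = 1 := by
  unfold acSimState acSimRun
  rw [AcSim.normSq_run_vec hG]
  exact normSq_basisState _

/-- **Eq. (10) for the family's circuit**: `‖U|input,0^m⟩ − V|input,0^m⟩‖₂ ≤ Σ_t 2√X_t`.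
[cite: AaronsonChen2017, §5.3 (p. 23, eq. (10))] -/
theorem l2Norm_acTrueState_sub_acSimState_le (hG : G.IsUnitary) (F : QCircuitFamily G)
    (O : Set (List Bool)) (c : ℕ) (input : List Bool) :
    l2Norm (acTrueState F O input - acSimState F O c input) ≤
      ((acSimLosses F O c input).map fun q => 2 * Real.sqrt q).sum :=
  AcSim.l2Norm_run_sub_le hG O _ _ (F.circ input.length).gates (acSimInit F input)

/-! ### Measuring close states (Cor. 2.5, in the Bernstein–Vazirani form) -/

/-- **Close unit vectors have close Born laws**: for unit vectors `u`, `v`,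
`‖Born(u) − Born(v)‖_TV ≤ ‖u − v‖₂` (`Σ_y | |u_y|² − |v_y|² | ≤ Σ_y |u_y − v_y|(|u_y| + |v_y|) ≤ 2‖u − v‖₂`
by Cauchy–Schwarz). Aaronson–Chen use the weaker `√(2‖u − v‖₂)` (Cor. 2.5, via Helstrom).
[cite: AaronsonChen2017, Cor. 2.5 (p. 13)] [cite: BennettBernsteinBrassardVazirani1997, Thm. 3.1] -/
theorem tvDist_bornPMF_le_l2Norm {M : ℕ} {u v : QReg M → ℂ} (hu : normSq u = 1) (hv : normSq v = 1) :
    (bornPMF u).tvDist (bornPMF v) ≤ l2Norm (u - v) := by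
  have hu' : ∑ y, ‖u y‖ ^ 2 = 1 := hu
  have hv' : ∑ y, ‖v y‖ ^ 2 = 1 := hv
  rw [PMF.tvDist, tsum_fintype]
  simp only [bornPMF_apply_of_sum_eq_one hu', bornPMF_apply_of_sum_eq_one hv',
    ENNReal.toReal_ofReal (sq_nonneg _)]
  have hterm : ∀ y, |‖u y‖ ^ 2 - ‖v y‖ ^ 2| ≤ ‖u y - v y‖ * ‖u y‖ + ‖u y - v y‖ * ‖v y‖ := by
    intro y
    rw [sq_sub_sq, abs_mul, abs_of_nonneg (by positivity : 0 ≤ ‖u y‖ + ‖v y‖)]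
    have h : |‖u y‖ - ‖v y‖| ≤ ‖u y - v y‖ := abs_norm_sub_norm_le _ _
    nlinarith [norm_nonneg (u y), norm_nonneg (v y), abs_nonneg (‖u y‖ - ‖v y‖)]
  have hA : ∑ y, ‖u y - v y‖ * ‖u y‖ ≤ l2Norm (u - v) * 1 := by
    refine (sum_mul_le_sqrt_mul_sqrt _ _ _).trans (le_of_eq ?_)
    rw [l2Norm_eq_sqrt_normSq, ← Real.sqrt_one]
    congr 1
    rw [← hu]
    rfl
  have hB : ∑ y, ‖u y - v y‖ * ‖v y‖ ≤ l2Norm (u - v) * 1 := by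
    refine (sum_mul_le_sqrt_mul_sqrt _ _ _).trans (le_of_eq ?_)
    rw [l2Norm_eq_sqrt_normSq, ← Real.sqrt_one]
    congr 1
    rw [← hv]
    rfl
  have hS : ∑ y, |‖u y‖ ^ 2 - ‖v y‖ ^ 2| ≤ 2 * l2Norm (u - v) := by
    calc ∑ y, |‖u y‖ ^ 2 - ‖v y‖ ^ 2|
        ≤ ∑ y, (‖u y - v y‖ * ‖u y‖ + ‖u y - v y‖ * ‖v y‖) := Finset.sum_le_sum fun y _ => hterm y
      _ = ∑ y, ‖u y - v y‖ * ‖u y‖ + ∑ y, ‖u y - v y‖ * ‖v y‖ := Finset.sum_add_distrib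
      _ ≤ 2 * l2Norm (u - v) := by linarith
  linarith

/-! ### The two halves of the printed proof, as named facts -/

/-- **Aaronson–Chen 2017, Lemma 5.3 — the `SampBPP^{TQBF,O}` machine** ("From our previous
analysis, `A` queries the oracle only `poly(n, 1/ε)` times. In addition, it is not hard to see
that all the computations can be done in `PSPACE`, and therefore can be implemented in
`poly(n, 1/ε)` time with the help of the `TQBF` oracle. So `A` is a `SampBPP` algorithm"): for
every `SampBQP` oracle algorithm in canonical form (a poly-time uniform Clifford+T family `F` with
query gates and a polynomial-time post-processing `post`) and every budget exponent `c`, there is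
a PPT oracle adversary `𝒜` (the tree's `SampBPP^{O'}` machines, `SampPRel`) which, run with the
oracle `TQBF ⊕ O` on `⟨x, 1^k⟩` (`k ≥ 1`), outputs a sample whose law is within total variation
`1/2k` of the post-processed Born law `acSimPMF F post O c ⟨x, 1^k⟩` of the replaced run — for
EVERY oracle `O` (the machine learns `O ∩ K_t` by querying the heavy tails, found by prefix search
with `TQBF` queries, and the small tables; it evaluates the query magnitudes of its own replaced
run and the conditional Born probabilities of `V|input, 0^m⟩` — computations in `PSPACE^{TQBF} =
PSPACE`, reduced to `TQBF` by its `PSPACE`-completeness — and samples by inverting the cumulative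
distribution against its coins, with slack `1/2k`). Needs, beyond the tree: `TQBF` is
`PSPACE`-hard in the tree's machine model (Stockmeyer–Meyer), a space-bounded relativized path-sum
evaluation of Clifford+T query circuits, and the sampler as an `OracleAlg` with `IsPolyTime`.
[cite: AaronsonChen2017, §5.3 (p. 23, proof of Lemma 5.3: "Analysis of the final circuit" and "So A is a SampBPP algorithm")] [cite: AroraBarakCC2009, Thm. 4.13 (TQBF is PSPACE-complete)] -/
def aaronsonChen2017_lem53_machine : Prop :=
  ∀ (F : QCircuitFamily cliffordT) (post : List Bool → List Bool), F.IsUniform →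
    PolyTimeComputable (id : List Bool → List Bool) (id : List Bool → List Bool) post →
    ∀ c : ℕ, ∃ 𝒜 : OracleAdversary (List Bool), 𝒜.IsPPT (encodingList Bool) ∧
      ∀ (x : List Bool) (k : ℕ), 0 < k → ∀ O : Set (List Bool),
        (PMF.map (fun o => o.getD [])
            (𝒜.outputPMF (Oracle.ofLanguage (oracleJoin TQBF O))
              (boolPair x (unaryEncodeNat k)))).tvDist
          (acSimPMF F post O c (boolPair x (unaryEncodeNat k))) ≤ 1 / (2 * (k : ℝ))

/-- **Aaronson–Chen 2017, Lemma 5.3 — the probabilistic analysis** ("over `O ∼ 𝒟_O`, for each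
`t ∈ [T]`, with probability `1 − exp(−(2n + ε⁻¹))/T`, we have
`‖U_{f_{n_t}} ⊗ I |v_t⟩ − U_{g_t} ⊗ I |v_t⟩‖ ≤ ε²/2T`. So by a simple union bound, with probability
at least `1 − exp(−(2n + ε⁻¹))`, the above bound holds for all `t ∈ [T]`"; from the posterior of
`𝒟_n` given the queries — blocks independent, an unknown string is a `1` with probability
`≤ 2^{-n}` — and the multiplicative Chernoff bound Cor. 2.7 for the sums `X = Σ_p X_p`,
`X_p ∈ [0, τ]`): for every Clifford+T query-circuit family `F` there is a budget exponent `c`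
such that for all `x` and `k ≥ 1`, with probability at least `1 − exp(−(2|x| + k))` over
`O ∼ 𝒟_O`, the error terms of the replaced run of `F` on `⟨x, 1^k⟩` satisfy `Σ_t 2√X_t ≤ 1/2k`
(the tree's reading of "`≤ ε²/2T` for all `t`", with the state-distance target `1/2k` of this
file's constants). [cite: AaronsonChen2017, §5.3 (pp. 22–23: posterior distribution, Cor. 2.7, eq. (9) and the union bound)] -/
def aaronsonChen2017_lem53_losses : Prop :=
  ∀ F : QCircuitFamily cliffordT, ∃ c : ℕ, ∀ (x : List Bool) (k : ℕ), 0 < k →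
    1 - Real.exp (-(2 * (x.length : ℝ) + k)) ≤
      acOracleMeasure.real {O : Set (List Bool) |
        ((acSimLosses F O c (boolPair x (unaryEncodeNat k))).map fun q => 2 * Real.sqrt q).sum ≤
          1 / (2 * (k : ℝ))}

/-- **Aaronson–Chen 2017, Lemma 5.3 — closeness of the final states** ("Therefore, with
probability at least `1 − exp(−(2n + ε⁻¹))`, we have `‖|v_{T+1}⟩ − |u_{T+1}⟩‖ =
‖U|0⟩^{⊗N} − V|0⟩^{⊗N}‖ ≤ ε²/2`"), with this file's target `1/2k`: for every `F` there is `c` such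
that for all `x`, `k ≥ 1`, with probability `≥ 1 − exp(−(2|x| + k))` over `O ∼ 𝒟_O`,
`‖U|input,0^m⟩ − V|input,0^m⟩‖₂ ≤ 1/2k`. Proved from `aaronsonChen2017_lem53_losses` below.
[cite: AaronsonChen2017, §5.3 (p. 23, "Upper-bounding the error")] -/
def aaronsonChen2017_lem53_analysis : Prop :=
  ∀ F : QCircuitFamily cliffordT, ∃ c : ℕ, ∀ (x : List Bool) (k : ℕ), 0 < k →
    1 - Real.exp (-(2 * (x.length : ℝ) + k)) ≤
      acOracleMeasure.real {O : Set (List Bool) |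
        l2Norm (acTrueState F O (boolPair x (unaryEncodeNat k)) -
            acSimState F O c (boolPair x (unaryEncodeNat k))) ≤ 1 / (2 * (k : ℝ))}

/-! ### The reductions (proved) -/

/-- State closeness from the losses bound, by eq. (10) (`l2Norm_acTrueState_sub_acSimState_le`)
and monotonicity of `𝒟_O`. [cite: AaronsonChen2017, §5.3 (p. 23, eqs. (9)–(10))] -/
theorem aaronsonChen2017_lem53_analysis_of_losses (h : aaronsonChen2017_lem53_losses) :
    aaronsonChen2017_lem53_analysis := by
  intro F
  obtain ⟨c, hc⟩ := h F
  refine ⟨c, fun x k hk => (hc x k hk).trans (measureReal_mono (fun O hO => ?_) (measure_ne_top _ _))⟩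
  simp only [Set.mem_setOf_eq] at hO ⊢
  exact (l2Norm_acTrueState_sub_acSimState_le cliffordT_isUnitary_holds F O c _).trans hO

/-- **Lemma 5.3 from its two halves**: the machine of `aaronsonChen2017_lem53_machine` is the
`SampBPP` algorithm `A`; on the event of `aaronsonChen2017_lem53_analysis`,
`‖𝒟^M − 𝒟^A‖ ≤ ‖Born(U|ψ⟩) − Born(V|ψ⟩)‖ + 1/2k ≤ ‖U|ψ⟩ − V|ψ⟩‖₂ + 1/2k ≤ 1/k` (data processing for
reading out and post-processing, `tvDist_bornPMF_le_l2Norm`, triangle inequality).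
[cite: AaronsonChen2017, §5.3 (p. 23, end of the proof of Lemma 5.3)] -/
theorem aaronsonChen2017_lem53_of_machine_of_analysis (hM : aaronsonChen2017_lem53_machine)
    (hA : aaronsonChen2017_lem53_analysis) : aaronsonChen2017_lem53 := by
  intro F post hU hpost
  obtain ⟨c, hc⟩ := hA F
  obtain ⟨𝒜, h𝒜, hsim⟩ := hM F post hU hpost c
  refine ⟨𝒜, h𝒜, fun x k hk => (hc x k hk).trans ?_⟩
  refine measureReal_mono (fun O hO => ?_) (measure_ne_top _ _)
  simp only [Set.mem_setOf_eq] at hO ⊢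
  set input : List Bool := boolPair x (unaryEncodeNat k) with hinput
  have hk' : (0 : ℝ) < k := by exact_mod_cast hk
  have h1 : ((F.kernel (oracleJoin TQBF O) input).map post).tvDist (acSimPMF F post O c input) ≤
      1 / (2 * (k : ℝ)) := by
    rw [kernel_eq_map_bornPMF_acTrueState]
    calc (((bornPMF (acTrueState F O input)).map List.ofFn).map post).tvDist (acSimPMF F post O c input)
        ≤ ((bornPMF (acTrueState F O input)).map List.ofFn).tvDist
            ((bornPMF (acSimState F O c input)).map List.ofFn) := PMF.tvDist_map_le_holds post _ _
      _ ≤ (bornPMF (acTrueState F O input)).tvDist (bornPMF (acSimState F O c input)) :=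
          PMF.tvDist_map_le_holds List.ofFn _ _
      _ ≤ l2Norm (acTrueState F O input - acSimState F O c input) :=
          tvDist_bornPMF_le_l2Norm (normSq_acTrueState cliffordT_isUnitary_holds F O input)
            (normSq_acSimState cliffordT_isUnitary_holds F O c input)
      _ ≤ 1 / (2 * (k : ℝ)) := hO
  have h2 : (acSimPMF F post O c input).tvDist
      (PMF.map (fun o => o.getD [])
        (𝒜.outputPMF (Oracle.ofLanguage (oracleJoin TQBF O)) input)) ≤ 1 / (2 * (k : ℝ)) := by
    rw [PMF.tvDist_comm]
    exact hsim x k hk O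
  calc ((F.kernel (oracleJoin TQBF O) input).map post).tvDist
        (PMF.map (fun o => o.getD [])
          (𝒜.outputPMF (Oracle.ofLanguage (oracleJoin TQBF O)) input))
      ≤ ((F.kernel (oracleJoin TQBF O) input).map post).tvDist (acSimPMF F post O c input) +
          (acSimPMF F post O c input).tvDist
            (PMF.map (fun o => o.getD [])
              (𝒜.outputPMF (Oracle.ofLanguage (oracleJoin TQBF O)) input)) :=
        PMF.tvDist_triangle_holds _ _ _
    _ ≤ 1 / (2 * (k : ℝ)) + 1 / (2 * (k : ℝ)) := add_le_add h1 h2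
    _ = 1 / (k : ℝ) := by
        field_simp
        ring

/-- **Decomposition of `aaronsonChen2017_lem53`**: Lemma 5.3 follows from the machine fact and the
losses fact. [cite: AaronsonChen2017, Lemma 5.3 (p. 21; proof pp. 21–23)] -/
theorem aaronsonChen2017_lem53_of_parts (hM : aaronsonChen2017_lem53_machine)
    (hL : aaronsonChen2017_lem53_losses) : aaronsonChen2017_lem53 :=
  aaronsonChen2017_lem53_of_machine_of_analysis hM (aaronsonChen2017_lem53_analysis_of_losses hL)

end Literature.Barriers.QuantumAdvantage

end
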